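import Mathlib

/-!
# Bałaban, CMP **102** (1985) 277–309 [B11] — (127)–(128) p. 297: the variational (Euler–Lagrange) equation of the
functional (81) on the constrained space, and its `Δ_a`-form

Honest framing: statement-level skeleton of published theorems with citation tags; proofs where landed; nothing
here is a claim about the Yang–Mills mass gap.

## What is printed (p. 297, render `…-p021-x2.png`)

«Let us notice that locally the only restriction on the configurations in the space are given by the first
equations in (126), therefore we obtain the following equation on `A′₁`,
`⟨δA′, J⟩ + ⟨δA′, (Δ − Δ^{(2)})A′₁⟩ + ⟨δA′, ((δ/δA′)V)(A′₁)⟩ = 0, (127)`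
for all `δA′` satisfying `QδA′ = 0`. The configuration `A′₁` satisfies `RD*A′₁ = 0`, hence the above equation can be
written as
`⟨δA′, J⟩ + ⟨δA′, Δ_aA′₁⟩ − ⟨δA′, Δ^{(2)}A′₁⟩ + ⟨δA′, ((δ/δA′)V)(A′₁)⟩ = 0, (128)`
where `Δ_a = Δ + DRD* + Q*aQ` (the constant `a = 1`).»

Here the functional is (81) p. 290, `𝔉(A′) = A(U₀) + ⟨A′, J⟩ + ½⟨A′, Δ₁A′⟩ + V(A′)` (on p. 297 with `Δ` for `Δ_π`,
`Δ₁ = Δ − Δ^{(2)}`), minimised over the configurations with prescribed averages (126), whose admissible variations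
are exactly `δA′` with `QδA′ = 0`.

## What is here (kernel-checked, sorry-free) — the abstract real-Hilbert-space content

* `functional81 c J Δ₁ V A = c + ⟪A, J⟫ + ½⟪A, Δ₁A⟫ + V A` and its restriction to a line `A₁ + tδ`
  (`functional81_line`, `Δ₁` symmetric), with derivative `⟪δ, J⟫ + ⟪δ, Δ₁A₁⟫ + DV(A₁)δ` at `t = 0`
  (`hasDerivAt_functional81_line`; `DV` = the Fréchet derivative of `V` at `A₁`, print's `⟨δA′, ((δ/δA′)V)(A′₁)⟩`).
* **(127)** `eq127`: if `t ↦ 𝔉(A₁ + tδA′)` has a local minimum at `t = 0` for every `δA′` in the subspace `T`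
  (print: `T = {QδA′ = 0}`), then `⟨δA′, J⟩ + ⟨δA′, Δ₁A′₁⟩ + DV(A′₁)δA′ = 0` for all `δA′ ∈ T`; `eq127_of_isMinOn`: the
  same from a minimum of `𝔉` on the affine space `A′₁ + T`.
* **(128)** `inner_laplaceA_apply` : for `Δ_a = Δ + D∘R∘D* + Q*∘(aQ)` with `⟨x, Q*y⟩ = ⟨Qx, y⟩`, `R(D*A′₁) = 0` and
  `QδA′ = 0` one has `⟨δA′, Δ_aA′₁⟩ = ⟨δA′, ΔA′₁⟩`; hence `eq128_iff_eq127` and `eq128`.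

## HONEST SCOPE — what is NOT claimed

The objects are abstract (three real inner-product spaces for fields / block data / gauge functions, linear maps
`Δ, Δ^{(2)}, D, R, D*, Q, Q*`); the identification of the constrained space (126) near `A′₁` with the affine space
`A′₁ + ker Q` («locally the only restriction … are given by the first equations in (126)») is the HYPOTHESIS
`hmin`, not derived from (123)–(126); existence of the minimiser `A′₁` (Prop. 5/7) and the regularity improvement
that follows (129)–(140) are not touched.  Nothing here is progress on the summit `Summit.QuantumFields`.
-/

open scoped InnerProductSpace

namespace Literature.MathematicalPhysics.QuantumFieldTheory.Balaban1983to89.B11Eq127EulerLagrange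

variable {E : Type*} [NormedAddCommGroup E] [InnerProductSpace ℝ E]

/-! ## §1 The functional (81) along a line and its derivative -/

/-- **(81)** `𝔉(A′) = A(U₀) + ⟨A′, J⟩ + ½⟨A′, Δ₁A′⟩ + V(A′)` (p. 297: `Δ₁ = Δ − Δ^{(2)}`), as a function of `A′` with the
data `c = A(U₀)`, `J`, `Δ₁`, `V`. [cite: Balaban1985Variational, (81) p.290, (127) p.297] -/
noncomputable def functional81 (c : ℝ) (J : E) (Δ₁ : E →ₗ[ℝ] E) (V : E → ℝ) (A : E) : ℝ :=
  c + ⟪A, J⟫_ℝ + 1 / 2 * ⟪A, Δ₁ A⟫_ℝ + V A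

/-- `𝔉(A₁ + tδ) = [𝔉(A₁) − V(A₁)] + t(⟨δ, J⟩ + ⟨δ, Δ₁A₁⟩) + t²·½⟨δ, Δ₁δ⟩ + V(A₁ + tδ)` for symmetric `Δ₁`
(API for (127)). [cite: Balaban1985Variational, (127) p.297] -/
theorem functional81_line (c : ℝ) (J : E) {Δ₁ : E →ₗ[ℝ] E} (hΔ : ∀ x y, ⟪Δ₁ x, y⟫_ℝ = ⟪x, Δ₁ y⟫_ℝ)
    (V : E → ℝ) (A₁ δ : E) (t : ℝ) :
    functional81 c J Δ₁ V (A₁ + t • δ) =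
      functional81 c J Δ₁ V A₁ - V A₁ + t * (⟪δ, J⟫_ℝ + ⟪δ, Δ₁ A₁⟫_ℝ) + t ^ 2 * (1 / 2 * ⟪δ, Δ₁ δ⟫_ℝ)
        + V (A₁ + t • δ) := by
  simp only [functional81, map_add, map_smul, inner_add_left, inner_add_right, real_inner_smul_left,
    real_inner_smul_right]
  rw [← hΔ A₁ δ, real_inner_comm δ (Δ₁ A₁)]
  ring

/-- The derivative of `t ↦ 𝔉(A₁ + tδ)` at `t = 0` is `⟨δ, J⟩ + ⟨δ, Δ₁A₁⟩ + ⟨δ, ((δ/δA′)V)(A₁)⟩`, the last pairing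
being the Fréchet derivative `DV` of `V` at `A₁` applied to `δ` (API for (127)). [cite: Balaban1985Variational, (127) p.297] -/
theorem hasDerivAt_functional81_line (c : ℝ) (J : E) {Δ₁ : E →ₗ[ℝ] E} (hΔ : ∀ x y, ⟪Δ₁ x, y⟫_ℝ = ⟪x, Δ₁ y⟫_ℝ)
    {V : E → ℝ} {A₁ : E} {DV : E →L[ℝ] ℝ} (hV : HasFDerivAt V DV A₁) (δ : E) :
    HasDerivAt (fun t : ℝ => functional81 c J Δ₁ V (A₁ + t • δ)) (⟪δ, J⟫_ℝ + ⟪δ, Δ₁ A₁⟫_ℝ + DV δ) 0 := by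
  have hline : HasDerivAt (fun t : ℝ => A₁ + t • δ) δ 0 := by
    simpa using ((hasDerivAt_id (0 : ℝ)).smul_const δ).const_add A₁
  have hVl : HasDerivAt (fun t : ℝ => V (A₁ + t • δ)) (DV δ) 0 := by
    have hV' : HasFDerivAt V DV (A₁ + (0 : ℝ) • δ) := by simpa using hV
    exact hV'.comp_hasDerivAt (0 : ℝ) hline
  have h1 : HasDerivAt (fun t : ℝ => t * (⟪δ, J⟫_ℝ + ⟪δ, Δ₁ A₁⟫_ℝ)) (⟪δ, J⟫_ℝ + ⟪δ, Δ₁ A₁⟫_ℝ) 0 := by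
    simpa using (hasDerivAt_id (0 : ℝ)).mul_const (⟪δ, J⟫_ℝ + ⟪δ, Δ₁ A₁⟫_ℝ)
  have h2 : HasDerivAt (fun t : ℝ => t ^ 2 * (1 / 2 * ⟪δ, Δ₁ δ⟫_ℝ)) 0 0 := by
    simpa using (hasDerivAt_pow 2 (0 : ℝ)).mul_const (1 / 2 * ⟪δ, Δ₁ δ⟫_ℝ)
  have h3 := ((h1.const_add (functional81 c J Δ₁ V A₁ - V A₁)).add h2).add hVl
  rw [add_zero] at h3
  have hfun : (fun t : ℝ => functional81 c J Δ₁ V (A₁ + t • δ)) = fun t : ℝ =>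
      functional81 c J Δ₁ V A₁ - V A₁ + t * (⟪δ, J⟫_ℝ + ⟪δ, Δ₁ A₁⟫_ℝ) + t ^ 2 * (1 / 2 * ⟪δ, Δ₁ δ⟫_ℝ)
        + V (A₁ + t • δ) := by
    funext t
    exact functional81_line c J hΔ V A₁ δ t
  rw [hfun]
  exact h3

/-! ## §2 (127): the variational equation in the admissible directions -/

/-- **(127)** `⟨δA′, J⟩ + ⟨δA′, (Δ − Δ^{(2)})A′₁⟩ + ⟨δA′, ((δ/δA′)V)(A′₁)⟩ = 0` for all `δA′` with `QδA′ = 0`: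
if for every admissible direction `δA′ ∈ T` (print: `T = {δA′ : QδA′ = 0}`) the function `t ↦ 𝔉(A′₁ + tδA′)` has a
local minimum at `t = 0`, then the first variation vanishes (`Δ₁ = Δ − Δ^{(2)}` symmetric, `V` Fréchet-differentiable
at `A′₁`). [cite: Balaban1985Variational, (127) p.297] -/
theorem eq127 {c : ℝ} {J : E} {Δ₁ : E →ₗ[ℝ] E} (hΔ : ∀ x y, ⟪Δ₁ x, y⟫_ℝ = ⟪x, Δ₁ y⟫_ℝ) {V : E → ℝ} {A₁ : E}
    {DV : E →L[ℝ] ℝ} (hV : HasFDerivAt V DV A₁) (T : Submodule ℝ E)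
    (hmin : ∀ δ ∈ T, IsLocalMin (fun t : ℝ => functional81 c J Δ₁ V (A₁ + t • δ)) 0) :
    ∀ δ ∈ T, ⟪δ, J⟫_ℝ + ⟪δ, Δ₁ A₁⟫_ℝ + DV δ = 0 :=
  fun δ hδ => (hmin δ hδ).hasDerivAt_eq_zero (hasDerivAt_functional81_line c J hΔ hV δ)

/-- (127) from a minimum of `𝔉` on the affine space `A′₁ + T` («locally the only restriction on the
configurations in the space are given by the first equations in (126)»: `A′₁` minimises among the `A′` with
`Q(A′ − A′₁) = 0`). [cite: Balaban1985Variational, (126)-(127) p.297] -/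
theorem eq127_of_isMinOn {c : ℝ} {J : E} {Δ₁ : E →ₗ[ℝ] E} (hΔ : ∀ x y, ⟪Δ₁ x, y⟫_ℝ = ⟪x, Δ₁ y⟫_ℝ)
    {V : E → ℝ} {A₁ : E} {DV : E →L[ℝ] ℝ} (hV : HasFDerivAt V DV A₁) (T : Submodule ℝ E)
    (hmin : IsMinOn (functional81 c J Δ₁ V) {A | A - A₁ ∈ T} A₁) :
    ∀ δ ∈ T, ⟪δ, J⟫_ℝ + ⟪δ, Δ₁ A₁⟫_ℝ + DV δ = 0 := by
  refine eq127 (c := c) hΔ hV T fun δ hδ => Filter.Eventually.of_forall fun t => ?_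
  have hmem : A₁ + t • δ ∈ {A | A - A₁ ∈ T} := by
    simp only [Set.mem_setOf_eq, add_sub_cancel_left]
    exact T.smul_mem t hδ
  simpa using (isMinOn_iff.mp hmin) (A₁ + t • δ) hmem

/-! ## §3 (128): the same equation with `Δ_a = Δ + DRD* + Q*aQ` -/

section DeltaA

variable {F : Type*} [NormedAddCommGroup F] [InnerProductSpace ℝ F]
variable {S : Type*} [AddCommGroup S] [Module ℝ S]

/-- `Δ_a = Δ + DRD* + Q*aQ` (p. 297; (3.25) of [5] with the constant `a`), over abstract field / block-data /
gauge-function spaces `E`, `F`, `S`. [cite: Balaban1985Variational, (128) p.297] -/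
def laplaceA (Δ : E →ₗ[ℝ] E) (D : S →ₗ[ℝ] E) (R : S →ₗ[ℝ] S) (Dstar : E →ₗ[ℝ] S) (Q : E →ₗ[ℝ] F)
    (Qadj : F →ₗ[ℝ] E) (a : ℝ) : E →ₗ[ℝ] E :=
  Δ + D ∘ₗ R ∘ₗ Dstar + Qadj ∘ₗ (a • Q)

/-- «The configuration `A′₁` satisfies `RD*A′₁ = 0`, hence» — together with `QδA′ = 0` and `⟨x, Q*y⟩ = ⟨Qx, y⟩` —
`⟨δA′, Δ_aA′₁⟩ = ⟨δA′, ΔA′₁⟩`. [cite: Balaban1985Variational, (128) p.297] -/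
theorem inner_laplaceA_apply {Δ : E →ₗ[ℝ] E} {D : S →ₗ[ℝ] E} {R : S →ₗ[ℝ] S} {Dstar : E →ₗ[ℝ] S}
    {Q : E →ₗ[ℝ] F} {Qadj : F →ₗ[ℝ] E} (hadj : ∀ x y, ⟪x, Qadj y⟫_ℝ = ⟪Q x, y⟫_ℝ) (a : ℝ) {A₁ δ : E}
    (hR : R (Dstar A₁) = 0) (hQ : Q δ = 0) :
    ⟪δ, laplaceA Δ D R Dstar Q Qadj a A₁⟫_ℝ = ⟪δ, Δ A₁⟫_ℝ := by
  simp only [laplaceA, LinearMap.add_apply, LinearMap.comp_apply, LinearMap.smul_apply, hR, map_zero, add_zero,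
    inner_add_right, hadj, hQ, inner_zero_left]

/-- **(128) ⇔ (127)** under `RD*A′₁ = 0`, `QδA′ = 0`: `⟨δA′, J⟩ + ⟨δA′, Δ_aA′₁⟩ − ⟨δA′, Δ^{(2)}A′₁⟩ + ⟨δA′, V′⟩ = 0 ↔
⟨δA′, J⟩ + ⟨δA′, (Δ − Δ^{(2)})A′₁⟩ + ⟨δA′, V′⟩ = 0`. [cite: Balaban1985Variational, (127)-(128) p.297] -/
theorem eq128_iff_eq127 {Δ Δ2 : E →ₗ[ℝ] E} {D : S →ₗ[ℝ] E} {R : S →ₗ[ℝ] S} {Dstar : E →ₗ[ℝ] S}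
    {Q : E →ₗ[ℝ] F} {Qadj : F →ₗ[ℝ] E} (hadj : ∀ x y, ⟪x, Qadj y⟫_ℝ = ⟪Q x, y⟫_ℝ) (a : ℝ) {A₁ δ J : E}
    (hR : R (Dstar A₁) = 0) (hQ : Q δ = 0) (v : ℝ) :
    ⟪δ, J⟫_ℝ + ⟪δ, laplaceA Δ D R Dstar Q Qadj a A₁⟫_ℝ - ⟪δ, Δ2 A₁⟫_ℝ + v = 0 ↔
      ⟪δ, J⟫_ℝ + ⟪δ, (Δ - Δ2) A₁⟫_ℝ + v = 0 := by
  rw [inner_laplaceA_apply hadj a hR hQ, LinearMap.sub_apply, inner_sub_right]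
  constructor <;> intro h <;> linarith

/-- **(128)** `⟨δA′, J⟩ + ⟨δA′, Δ_aA′₁⟩ − ⟨δA′, Δ^{(2)}A′₁⟩ + ⟨δA′, ((δ/δA′)V)(A′₁)⟩ = 0` for all `δA′` with
`QδA′ = 0`, from (127) (local minimality of `𝔉` along admissible lines, `Δ₁ = Δ − Δ^{(2)}` symmetric) and
`RD*A′₁ = 0`. [cite: Balaban1985Variational, (128) p.297] -/
theorem eq128 {c : ℝ} {J : E} {Δ Δ2 : E →ₗ[ℝ] E} (hΔ : ∀ x y, ⟪(Δ - Δ2) x, y⟫_ℝ = ⟪x, (Δ - Δ2) y⟫_ℝ)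
    {V : E → ℝ} {A₁ : E} {DV : E →L[ℝ] ℝ} (hV : HasFDerivAt V DV A₁)
    {D : S →ₗ[ℝ] E} {R : S →ₗ[ℝ] S} {Dstar : E →ₗ[ℝ] S} {Q : E →ₗ[ℝ] F} {Qadj : F →ₗ[ℝ] E}
    (hadj : ∀ x y, ⟪x, Qadj y⟫_ℝ = ⟪Q x, y⟫_ℝ) (a : ℝ) (hR : R (Dstar A₁) = 0)
    (hmin : ∀ δ ∈ LinearMap.ker Q, IsLocalMin (fun t : ℝ => functional81 c J (Δ - Δ2) V (A₁ + t • δ)) 0) :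
    ∀ δ ∈ LinearMap.ker Q,
      ⟪δ, J⟫_ℝ + ⟪δ, laplaceA Δ D R Dstar Q Qadj a A₁⟫_ℝ - ⟪δ, Δ2 A₁⟫_ℝ + DV δ = 0 := by
  intro δ hδ
  rw [eq128_iff_eq127 hadj a hR (LinearMap.mem_ker.mp hδ)]
  exact eq127 hΔ hV (LinearMap.ker Q) hmin δ hδ

end DeltaA

end Literature.MathematicalPhysics.QuantumFieldTheory.Balaban1983to89.B11Eq127EulerLagrange
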